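import Literature.NumberTheory.EllipticCurves.GreenbergVatsal2000.GreenbergSelmerGroups
import Summits.BirchSwinnertonDyer.Rank1Residual.X2.ResidualDevissage
import HarnessLib

/-!
# Greenberg–Vatsal 2000, §2 display (16) — the devissage of a residual Selmer group along
# `0 → Φ → M → Ψ → 0`, PART 2: Greenberg local conditions and the count
# `#S^{Σ₀}_M(L) = #H¹(ℚ_Σ/L, Φ) · #S^{Σ₀}_Ψ(L)`

HONEST FRAMING (cell `b2b-bsdres`, run/shared/lean/b2b/bsd-rank1-residual/, verbatim in every
file): the goal of the cell is to DELETE the COMBINATION-SHAPED residual classes of the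
Birch–Swinnerton-Dyer formula for ALL analytic-rank `≤ 1` elliptic curves over `ℚ` — "full BSD
formula for every rank `≤ 1` curve in class `C`" assembled STRICTLY from published theorems — so
that the rank-`≤ 1` remainder becomes exactly the CONSTRUCTION-SHAPED classes, which are TYPED
(missing-input `Prop`s), NOT attempted. This is not "finishing BSD". Sub-cell
`b2b-bsdres-eisenstein-p2` (CLASS-OWNERS row "X2"), gen 16: research route; NO CLAIM BEYOND STATED
CLASSES; nothing here changes a label; no named fact; every declaration is a definition with a
body or a proved theorem.

WHAT. Greenberg–Vatsal (arXiv:math/9906215 pp. 28–30) compute the residual Selmer group of an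
Eisenstein curve from `0 → Φ → E[p] → Ψ → 0` (`Φ = C[p]` the ramified-even line — for the Tate
curve at `p ‖ N`, `C[p] = μ_p ⊗ δ` —, `Ψ` the unramified-odd quotient): "`H⁰(ℚ_∞, A_ψ) = 0` …
[for `A_φ`] we must take `W_p = V_p`. Therefore `𝓗_p(ℚ_∞, A) = 0` … [for `A_ψ`] the local
condition at `p` … is that a cocycle class be unramified. Thus `S_A(ℚ_∞) = H¹_unr(ℚ_Σ/ℚ_∞, A)` …
`λ^alg_{E,Σ₀} = λ_{φ,Σ₀} + λ_{ψ,Σ₀}` (16) … We must just explain why `H²(ℚ_Σ/ℚ_∞, Φ) = 0`."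
THIS FILE proves that devissage for the tree's Greenberg–Vatsal Selmer groups
(`GreenbergVatsal2000.datumSelmer H M p N S₀ = S^{Σ₀}_M(L)`, `unramifiedOutside = H¹(ℚ_Σ/L, ·)`,
`unramifiedKer`) over ANY number field `K`, normal `H ≤ Γ_K` (fixed field `L`; `H = ker κ` for
`L = K_∞`), short exact sequence of discrete `Γ_K`-modules `Φ ↪ M ↠ Ψ` with `M` unramified
outside `S₀ ∪ {v ∣ p}`, and Greenberg data with `M⁺_v = ker (M → Ψ)` at every `v ∣ p` — the shape
of GV's residual datum at an Eisenstein prime, good ordinary OR multiplicative. The two printed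
inputs of (16) that are not about `E` are HYPOTHESES here: (a) `M^H → Ψ^H` onto (GV: `ψ` odd ⇒
`H⁰(ℚ_∞, Ψ) = 0`; criterion `ResidualDevissage.forall_fixed_eq_zero_of_smul_eq_neg`); (b) the
LIFTING property `S^{Σ₀}_Ψ(L) ⊆ q_* H¹(ℚ_Σ/L, M)` (GV: `H²(ℚ_Σ/ℚ_∞, Φ) = 0`, Ferrero–Washington +
Iwasawa + Greenberg 1999 Prop. 4 — character-theoretic). The `E`-side instantiation (Tate /
reduction datum of gens 9–13) is the successor file; the character counts
`#H¹(ℚ_Σ/ℚ_∞, Φ) = p^{λ_{φ,Σ₀}}`, `#S^{Σ₀}_Ψ(ℚ_∞) = p^{λ_{ψ,Σ₀}}` (Iwasawa, Mazur–Wiles,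
Ferrero–Washington) and the analytic congruence (GV Thm. (3.11), whose proof PRINTS the `p ∣ M`
paragraph) are the published inputs the X2a chain will cite against this kernel devissage.

CONTENT. §1 (over `L = K̄^H`): `subH1 H i hi = i_*`, `inertiaH1`; naturality `conjH1_subH1`,
`res_subH1`; transport of "unramified" forward (`subH1_mem_unramifiedKer/Outside`) and BACKWARD
(`mem_unramifiedKer/Outside_of_subH1`: inertia acting trivially on `M` makes
`H¹(H ⊓ I_v, Φ) → H¹(H ⊓ I_v, M)` injective); **`mem_greenbergKer_iff_mem_unramifiedKer`** (Greenberg's condition at `v ∣ p` on `c` IS "`q_* c`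
unramified at `v`"). §2 `quotSelmer H Ψ p S₀ = S^{Σ₀}_Ψ(L)`; `subH1_mem_datumSelmer`
(`i_* H¹(ℚ_Σ/L, Φ) ⊆ S^{Σ₀}_M(L)`), `subH1_mem_quotSelmer` (`q_* S^{Σ₀}_M ⊆ S^{Σ₀}_Ψ`),
`exists_mem_unramifiedOutside_subH1_eq` (`ker q_* ∩ S^{Σ₀}_M = i_* H¹(ℚ_Σ/L, Φ)`),
`mem_datumSelmer_of_subH1_mem_quotSelmer`, and THE COUNT **`natCard_datumSelmer_eq_mul`**.

References: Greenberg–Vatsal, Invent. Math. 142 (2000) 17–63 = arXiv:math/9906215, §2 pp. 16–17,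
20, 23, 25, 28–30 (display (16)); Greenberg, LNM 1716 (1999) §2, Prop. 4; Serre, *Galois
Cohomology* I.§2.4–2.5; Neukirch–Schmidt–Wingberg I.§5.
-/

noncomputable section

open scoped Classical

universe u

namespace Summit.BirchSwinnertonDyer.Rank1Residual.X2.ResidualDevissageSelmer

open Literature.NumberTheory.EllipticCurves Literature.NumberTheory.GaloisRepresentations
open NumberField IsDedekindDomain Field
open Literature.NumberTheory.EllipticCurves.GreenbergSelmer
open Literature.NumberTheory.EllipticCurves.GreenbergVatsal2000 hiding unramifiedKer
open Summit.BirchSwinnertonDyer.Rank1Residual.X2.ResidualDevissage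

/-! ## §1. Over `L = K̄^H`: naturality, ramification transport, Greenberg's condition at `p` -/

section NumberField

variable {K : Type u} [Field K] [NumberField K]
variable (H : Subgroup (absoluteGaloisGroup K)) [H.Normal]
variable {Φ : Type u} [AddCommGroup Φ] [DistribMulAction (absoluteGaloisGroup K) Φ]
  [TopologicalSpace Φ] [DiscreteTopology Φ]
variable {M : Type u} [AddCommGroup M] [DistribMulAction (absoluteGaloisGroup K) M]
  [TopologicalSpace M] [DiscreteTopology M]
variable {Ψ : Type u} [AddCommGroup Ψ] [DistribMulAction (absoluteGaloisGroup K) Ψ]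
  [TopologicalSpace Ψ] [DiscreteTopology Ψ]
variable (i : Φ →+ M) (hi : ∀ (g : absoluteGaloisGroup K) (x : Φ), i (g • x) = g • i x)

/-- `i_* : H¹(H, Φ) → H¹(H, M)` over `L = K̄^H` for a `Γ_K`-equivariant `i` (restricted action
of `H`). [folklore] -/
abbrev subH1 : subgroupH1 H Φ →+ subgroupH1 H M :=
  resH1Hom (ContinuousMonoidHom.id H) i fun h x ↦ hi h x

/-- `i_*` on `H¹(H ⊓ I_v, ·)` (the group `inertiaIn H v ≤ D_v`, restricted action). [folklore] -/
abbrev inertiaH1 (v : HeightOneSpectrum (𝓞 K)) :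
    discreteH1 (inertiaIn H v) Φ →+ discreteH1 (inertiaIn H v) M :=
  resH1Hom (ContinuousMonoidHom.id (inertiaIn H v)) i fun x y ↦
    hi ((x : decomp v) : absoluteGaloisGroup K) y

variable {H i hi}

omit [NumberField K] in
/-- **Naturality w.r.t. conjugation**: `σ · (i_* c) = i_* (σ · c)` for `σ ∈ Γ_K`
(`resH1Hom_comp` on both sides; `i` commutes with `σ`). Neukirch–Schmidt–Wingberg I.§5.
[folklore] -/
theorem conjH1_subH1 (σ : absoluteGaloisGroup K) (c : subgroupH1 H Φ) :
    conjH1 H M σ (subH1 H i hi c) = subH1 H i hi (conjH1 H Φ σ c) := by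
  have hcomp : (conjH1 H M σ).comp (subH1 H i hi) = (subH1 H i hi).comp (conjH1 H Φ σ) := by
    rw [conjH1, conjH1, resH1Hom_comp, resH1Hom_comp]
    exact resH1Hom_congr (by ext; rfl) (by ext x; simp [hi]) _ _
  exact DFunLike.congr_fun hcomp c

omit [H.Normal] in
/-- **Naturality w.r.t. restriction to `H ⊓ I_v`**: `res (i_* c) = i_* (res c)`.
Serre, *Galois Cohomology* I.§2.4. [folklore] -/
theorem res_subH1 (v : HeightOneSpectrum (𝓞 K)) (c : subgroupH1 H Φ) :
    resH1Hom (inertiaInToH H v) (AddMonoidHom.id M) (fun _ _ ↦ rfl) (subH1 H i hi c) =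
      inertiaH1 H i hi v (resH1Hom (inertiaInToH H v) (AddMonoidHom.id Φ) (fun _ _ ↦ rfl) c) := by
  have hcomp : (resH1Hom (inertiaInToH H v) (AddMonoidHom.id M) (fun _ _ ↦ rfl)).comp
        (subH1 H i hi) =
      (inertiaH1 H i hi v).comp
        (resH1Hom (inertiaInToH H v) (AddMonoidHom.id Φ) (fun _ _ ↦ rfl)) := by
    rw [resH1Hom_comp, resH1Hom_comp]
    exact resH1Hom_congr (by ext; rfl) (by ext; rfl) _ _
  exact DFunLike.congr_fun hcomp c

omit [H.Normal] in
/-- `i_*` preserves "unramified at `v`". [cite: GreenbergVatsal2000, §2 p. 17] -/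
theorem subH1_mem_unramifiedKer (v : HeightOneSpectrum (𝓞 K)) {c : subgroupH1 H Φ}
    (hc : c ∈ GreenbergVatsal2000.unramifiedKer H Φ v) :
    subH1 H i hi c ∈ GreenbergVatsal2000.unramifiedKer H M v := by
  rw [GreenbergVatsal2000.unramifiedKer, AddMonoidHom.mem_ker] at hc ⊢
  rw [res_subH1, hc, map_zero]

/-- `i_*` maps `H¹(ℚ_Σ/L, Φ)` into `H¹(ℚ_Σ/L, M)` (`Σ = S₀ ∪ {p, ∞}`).
[cite: GreenbergVatsal2000, §2 pp. 16, 23] -/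
theorem subH1_mem_unramifiedOutside (p : ℕ) (S₀ : Set (HeightOneSpectrum (𝓞 K)))
    {c : subgroupH1 H Φ} (hc : c ∈ unramifiedOutside H Φ p S₀) :
    subH1 H i hi c ∈ unramifiedOutside H M p S₀ := by
  rw [mem_unramifiedOutside_iff] at hc ⊢
  intro v hv hpv σ
  rw [conjH1_subH1]
  exact subH1_mem_unramifiedKer v (hc v hv hpv σ)

variable {q : M →+ Ψ}

omit [H.Normal] [TopologicalSpace Ψ] [DiscreteTopology Ψ] in
/-- **Backward transport of "unramified at `v`" along `i_*` when inertia acts trivially on `M`**: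
if `I_v ∩ H` fixes `M` pointwise (e.g. `M` unramified at `v`) and `0 → Φ → M → Ψ → 0` is exact,
then `H¹(H ⊓ I_v, Φ) → H¹(H ⊓ I_v, M)` is injective (`M^{I} = M ↠ Ψ ⊇ Ψ^{I}`), so `i_* c`
unramified at `v` forces `c` unramified at `v`. This is why GV may work inside `H¹(ℚ_Σ/ℚ_∞, ·)`
throughout (16). [cite: GreenbergVatsal2000, §2 pp. 16–17, 29] -/
theorem mem_unramifiedKer_of_subH1 (v : HeightOneSpectrum (𝓞 K))
    (hq : ∀ (g : absoluteGaloisGroup K) (m : M), q (g • m) = g • q m)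
    (hinj : Function.Injective i)
    (hqsurj : Function.Surjective q) (hexact : ∀ m, q m = 0 → m ∈ i.range)
    (hqi : ∀ x, q (i x) = 0)
    (htriv : ∀ (x : inertiaIn H v) (m : M), x • m = m) {c : subgroupH1 H Φ}
    (hc : subH1 H i hi c ∈ GreenbergVatsal2000.unramifiedKer H M v) :
    c ∈ GreenbergVatsal2000.unramifiedKer H Φ v := by
  rw [GreenbergVatsal2000.unramifiedKer, AddMonoidHom.mem_ker] at hc ⊢
  rw [res_subH1] at hc
  have hinjI : Function.Injective (inertiaH1 H i hi v) :=
    pushH1_injective_of_surjOn_fixed (q := q)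
      (fun x m ↦ hq ((x : decomp v) : absoluteGaloisGroup K) m) hinj hexact hqi fun y _ ↦ by
        obtain ⟨m, rfl⟩ := hqsurj y
        exact ⟨m, fun x ↦ htriv x m, rfl⟩
  exact (injective_iff_map_eq_zero _).1 hinjI _ hc

omit [TopologicalSpace Ψ] [DiscreteTopology Ψ] in
/-- Backward transport of `H¹(ℚ_Σ/L, ·)`: if `M` is unramified at every finite `v ∉ S₀`, `v ∤ p`
(inertia `I_v` acts trivially) then `i_* c ∈ H¹(ℚ_Σ/L, M)` forces `c ∈ H¹(ℚ_Σ/L, Φ)`.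
[cite: GreenbergVatsal2000, §2 pp. 16–17, 29] -/
theorem mem_unramifiedOutside_of_subH1 (p : ℕ) (S₀ : Set (HeightOneSpectrum (𝓞 K)))
    (hq : ∀ (g : absoluteGaloisGroup K) (m : M), q (g • m) = g • q m)
    (hinj : Function.Injective i) (hqsurj : Function.Surjective q)
    (hexact : ∀ m, q m = 0 → m ∈ i.range) (hqi : ∀ x, q (i x) = 0)
    (hunr : ∀ v : HeightOneSpectrum (𝓞 K), v ∉ S₀ → ((p : ℕ) : 𝓞 K) ∉ v.asIdeal →
      ∀ x ∈ inertia v, ∀ m : M, x • m = m)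
    {c : subgroupH1 H Φ} (hc : subH1 H i hi c ∈ unramifiedOutside H M p S₀) :
    c ∈ unramifiedOutside H Φ p S₀ := by
  rw [mem_unramifiedOutside_iff] at hc ⊢
  intro v hv hpv σ
  have h1 := hc v hv hpv σ
  rw [conjH1_subH1] at h1
  refine mem_unramifiedKer_of_subH1 v hq hinj hqsurj hexact hqi (fun x m ↦ ?_) h1
  exact hunr v hv hpv _ ((mem_inertiaIn_iff H v _).1 x.2).2 m

/-! ### Greenberg's condition at `v ∣ p` for a datum with `M⁺_v = ker q` -/

omit [H.Normal] in
/-- **Greenberg's condition at `v ∣ p` = "`q_* c` is unramified at `v`"** for a datum with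
`M⁺_v = ker q`, `q : M ↠ Ψ`: the local map `H¹(H, M) → H¹(H ⊓ I_v, M ⧸ M⁺_v)` is
`H¹(H ⊓ I_v, e) ∘ res ∘ q_*` with `H¹(H ⊓ I_v, e)` injective. For GV's residual datum
(`Φ = C[p]`, `Ψ = E[p]/C[p] = D[p]`): "`[σ]` is in `S_A(ℚ_∞)` if and only if … the image in
`H¹(I_𝔭, D)` is trivial" (p. 16) read on `E[p]`. [cite: GreenbergVatsal2000, §2 pp. 16, 29] -/
theorem mem_greenbergKer_iff_mem_unramifiedKer {v : HeightOneSpectrum (𝓞 K)}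
    (hq : ∀ (g : absoluteGaloisGroup K) (m : M), q (g • m) = g • q m)
    (N : LocalDatum K M v) (hN : N.plus = q.ker) (hqsurj : Function.Surjective q)
    (c : subgroupH1 H M) :
    c ∈ N.greenbergKer H ↔ subH1 H q hq c ∈ GreenbergVatsal2000.unramifiedKer H Ψ v := by
  -- `e : M ⧸ M⁺_v → Ψ` induced by `q` (`M⁺_v = ker q`): bijective, `H ⊓ I_v`-equivariant
  let e : N.Gr →+ Ψ :=
    QuotientAddGroup.lift N.plus q fun m hm ↦ by rwa [hN, AddMonoidHom.mem_ker] at hm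
  have he_mk : ∀ m : M, e (N.grMk m) = q m := fun _ ↦ rfl
  have he : ∀ (x : inertiaIn H v) (y : N.Gr),
      e (ContinuousMonoidHom.id (inertiaIn H v) x • y) = x • e y := fun x y ↦ by
    obtain ⟨m, rfl⟩ := N.grMk_surjective y
    change e ((x : decomp v) • N.grMk m) = _
    rw [LocalDatum.smul_grMk, he_mk, he_mk, hq]
    rfl
  have hbij : Function.Bijective e := by
    refine ⟨(injective_iff_map_eq_zero _).2 fun x hx ↦ ?_, fun y ↦ ?_⟩
    · obtain ⟨m, rfl⟩ := N.grMk_surjective x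
      rw [he_mk, ← AddMonoidHom.mem_ker, ← hN] at hx
      rwa [← AddMonoidHom.mem_ker, N.ker_grMk]
    · obtain ⟨m, rfl⟩ := hqsurj y
      exact ⟨N.grMk m, he_mk m⟩
  have hinjE : Function.Injective (resH1Hom (ContinuousMonoidHom.id (inertiaIn H v)) e he) :=
    pushH1_injective_of_bijective hbij
  -- `H¹(e) ∘ greenbergMap = res ∘ q_*`
  have hcomp : (resH1Hom (ContinuousMonoidHom.id (inertiaIn H v)) e he).comp (N.greenbergMap H) =
      (resH1Hom (inertiaInToH H v) (AddMonoidHom.id Ψ) (fun _ _ ↦ rfl)).comp (subH1 H q hq) := by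
    rw [LocalDatum.greenbergMap, resH1Hom_comp, resH1Hom_comp]
    exact resH1Hom_congr (by ext; rfl) (by ext m; rfl) _ _
  rw [LocalDatum.mem_greenbergKer_iff, GreenbergVatsal2000.unramifiedKer, AddMonoidHom.mem_ker,
    ← AddMonoidHom.comp_apply, ← hcomp, AddMonoidHom.comp_apply]
  constructor
  · intro h; rw [h, map_zero]
  · intro h; exact (injective_iff_map_eq_zero _).1 hinjE _ h

/-! ## §2. The residual Selmer groups of `Φ` and `Ψ`, and the devissage count -/

variable (H) in
/-- **`S^{Σ₀}_Ψ(L)`** for the quotient module with ZERO Greenberg datum (`C_Ψ = 0`, `D_Ψ = Ψ`):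
the classes of `H¹(H, Ψ)` unramified at EVERY finite place `v ∉ S₀` — outside `S₀ ∪ {v ∣ p}` as for
`H¹(ℚ_Σ/L, ·)`, and AT `v ∣ p` because Greenberg's condition for the zero datum is "unramified":
GV p. 29 "we must take `W_p = 0`. That is, the local condition at `p` occurring in the definition of
`S_A(ℚ_∞)` is that a cocycle class be unramified. Thus `S_A(ℚ_∞) = H¹_unr(ℚ_Σ/ℚ_∞, A)`" (with
`Σ₀`: no condition at `Σ₀`, p. 20). [cite: GreenbergVatsal2000, §2 pp. 20, 29] -/
def quotSelmer (Ψ : Type u) [AddCommGroup Ψ] [DistribMulAction (absoluteGaloisGroup K) Ψ]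
    [TopologicalSpace Ψ] [DiscreteTopology Ψ] (p : ℕ) (S₀ : Set (HeightOneSpectrum (𝓞 K))) :
    AddSubgroup (subgroupH1 H Ψ) :=
  unramifiedOutside H Ψ p S₀ ⊓
    ⨅ (v : HeightOneSpectrum (𝓞 K)) (_ : ((p : ℕ) : 𝓞 K) ∈ v.asIdeal) (σ : absoluteGaloisGroup K),
      (GreenbergVatsal2000.unramifiedKer H Ψ v).comap (conjH1 H Ψ σ)

/-- Membership in `S^{Σ₀}_Ψ(L)`. [cite: GreenbergVatsal2000, §2 pp. 20, 29] -/
theorem mem_quotSelmer_iff {p : ℕ} {S₀ : Set (HeightOneSpectrum (𝓞 K))} (c : subgroupH1 H Ψ) :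
    c ∈ quotSelmer H Ψ p S₀ ↔
      c ∈ unramifiedOutside H Ψ p S₀ ∧
        ∀ (v : HeightOneSpectrum (𝓞 K)), ((p : ℕ) : 𝓞 K) ∈ v.asIdeal →
          ∀ σ : absoluteGaloisGroup K,
            conjH1 H Ψ σ c ∈ GreenbergVatsal2000.unramifiedKer H Ψ v := by
  simp only [quotSelmer, AddSubgroup.mem_inf, AddSubgroup.mem_iInf, AddSubgroup.mem_comap]

variable {p : ℕ} {N : Data K M p} {S₀ : Set (HeightOneSpectrum (𝓞 K))}

/-- **`i_* H¹(ℚ_Σ/L, Φ) ⊆ S^{Σ₀}_M(L)`** for data with `M⁺_v = ker q ⊇ im i`: classes coming from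
`Φ` satisfy Greenberg's condition at every `v ∣ p` automatically (`q_* i_* = 0`) — GV p. 29: for
`A_φ` "we must take `W_p = V_p`. Therefore `𝓗_p(ℚ_∞, A) = 0`", i.e. `S^{Σ₀}_Φ = H¹(ℚ_Σ/ℚ_∞, Φ)`.
[cite: GreenbergVatsal2000, §2 pp. 20, 29] -/
theorem subH1_mem_datumSelmer
    (hq : ∀ (g : absoluteGaloisGroup K) (m : M), q (g • m) = g • q m)
    (hN : ∀ v hv, (N v hv).plus = q.ker)
    (hqsurj : Function.Surjective q) (hqi : ∀ x, q (i x) = 0) {a : subgroupH1 H Φ}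
    (ha : a ∈ unramifiedOutside H Φ p S₀) : subH1 H i hi a ∈ datumSelmer H M p N S₀ := by
  rw [mem_datumSelmer_iff]
  refine ⟨subH1_mem_unramifiedOutside p S₀ ha, fun v hv σ ↦ ?_⟩
  rw [mem_greenbergKer_iff_mem_unramifiedKer hq (N v hv) (hN v hv) hqsurj, conjH1_subH1,
    GreenbergVatsal2000.unramifiedKer, AddMonoidHom.mem_ker]
  rw [pushH1_pushH1_eq_zero hqi, map_zero]

/-- **`q_* S^{Σ₀}_M(L) ⊆ S^{Σ₀}_Ψ(L)`**: Greenberg's condition at `v ∣ p` on `c` is exactly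
"`q_* c` unramified at `v`". [cite: GreenbergVatsal2000, §2 pp. 16, 29] -/
theorem subH1_mem_quotSelmer
    (hq : ∀ (g : absoluteGaloisGroup K) (m : M), q (g • m) = g • q m)
    (hN : ∀ v hv, (N v hv).plus = q.ker)
    (hqsurj : Function.Surjective q) {c : subgroupH1 H M} (hc : c ∈ datumSelmer H M p N S₀) :
    subH1 H q hq c ∈ quotSelmer H Ψ p S₀ := by
  rw [mem_datumSelmer_iff] at hc
  rw [mem_quotSelmer_iff]
  refine ⟨subH1_mem_unramifiedOutside p S₀ hc.1, fun v hv σ ↦ ?_⟩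
  rw [conjH1_subH1, ← mem_greenbergKer_iff_mem_unramifiedKer hq (N v hv) (hN v hv) hqsurj]
  exact hc.2 v hv σ

/-- **The kernel of `q_*` on `S^{Σ₀}_M(L)` comes from `H¹(ℚ_Σ/L, Φ)`**: exactness at `H¹(H, M)`
plus backward ramification transport (`M` unramified outside `S₀ ∪ {v ∣ p}`).
[cite: GreenbergVatsal2000, §2 pp. 29–30 (display (16))] -/
theorem exists_mem_unramifiedOutside_subH1_eq
    (hq : ∀ (g : absoluteGaloisGroup K) (m : M), q (g • m) = g • q m)
    (hM : ∀ m : M, Continuous fun g : absoluteGaloisGroup K ↦ g • m)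
    (hinj : Function.Injective i) (hqsurj : Function.Surjective q)
    (hexact : ∀ m, q m = 0 → m ∈ i.range) (hqi : ∀ x, q (i x) = 0)
    (hunr : ∀ v : HeightOneSpectrum (𝓞 K), v ∉ S₀ → ((p : ℕ) : 𝓞 K) ∉ v.asIdeal →
      ∀ x ∈ inertia v, ∀ m : M, x • m = m)
    {c : subgroupH1 H M} (hc : c ∈ datumSelmer H M p N S₀) (hc0 : subH1 H q hq c = 0) :
    ∃ a ∈ unramifiedOutside H Φ p S₀, subH1 H i hi a = c := by
  have hMH : ∀ m : M, Continuous fun h : H ↦ h • m := fun m ↦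
    (hM m).comp continuous_subtype_val
  obtain ⟨a, rfl⟩ := mem_range_pushH1_of_pushH1_eq_zero (G := H) (i := i)
    (hi := fun h x ↦ hi h x) hMH hinj hqsurj hexact hc0
  exact ⟨a, mem_unramifiedOutside_of_subH1 (hi := hi) p S₀ hq hinj hqsurj hexact hqi hunr
    (datumSelmer_le_unramifiedOutside H M p N S₀ hc), rfl⟩

/-- **Lifts land in `S^{Σ₀}_M(L)`**: if `s ∈ S^{Σ₀}_Ψ(L)` lifts to SOME `c ∈ H¹(ℚ_Σ/L, M)` then that
`c` lies in `S^{Σ₀}_M(L)` (its Greenberg condition at `v ∣ p` is the unramifiedness of `s`). The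
lifting itself is GV's "`H²(ℚ_Σ/ℚ_∞, Φ) = 0`" (pp. 29–30), a hypothesis here.
[cite: GreenbergVatsal2000, §2 pp. 29–30] -/
theorem mem_datumSelmer_of_subH1_mem_quotSelmer
    (hq : ∀ (g : absoluteGaloisGroup K) (m : M), q (g • m) = g • q m)
    (hN : ∀ v hv, (N v hv).plus = q.ker)
    (hqsurj : Function.Surjective q) {c : subgroupH1 H M} (hc : c ∈ unramifiedOutside H M p S₀)
    (hs : subH1 H q hq c ∈ quotSelmer H Ψ p S₀) : c ∈ datumSelmer H M p N S₀ := by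
  rw [mem_quotSelmer_iff] at hs
  rw [mem_datumSelmer_iff]
  refine ⟨hc, fun v hv σ ↦ ?_⟩
  rw [mem_greenbergKer_iff_mem_unramifiedKer hq (N v hv) (hN v hv) hqsurj, ← conjH1_subH1]
  exact hs.2 v hv σ

/-- **THE DEVISSAGE COUNT (Greenberg–Vatsal (16), structural form).** For a short exact sequence
`0 → Φ → M → Ψ → 0` of discrete `Γ_K`-modules (`M` with continuous orbit maps, unramified outside
`S₀ ∪ {v ∣ p}`), Greenberg data on `M` with `M⁺_v = ker (M → Ψ)` at every `v ∣ p`, a normal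
`H ≤ Γ_K` with `M^H → Ψ^H` onto (e.g. `Ψ^H = 0`), and the lifting property
`S^{Σ₀}_Ψ(L) ⊆ q_* H¹(ℚ_Σ/L, M)` (GV: `H²(ℚ_Σ/ℚ_∞, Φ) = 0`):
`#S^{Σ₀}_M(L) = #H¹(ℚ_Σ/L, Φ) · #S^{Σ₀}_Ψ(L)` (as `Nat.card`; both sides `0` when infinite).
With `M = E[p]`, `Φ = C[p]` (ramified-even line), `Ψ = E[p]/C[p]` (unramified-odd), `L = ℚ_∞`
this is `dim S^{Σ₀}_{E[p]}(ℚ_∞) = λ_{φ,Σ₀} + λ_{ψ,Σ₀}`, the `E`-dependent step of display (16)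
— valid verbatim for the Tate datum at `p ‖ N`.
[cite: GreenbergVatsal2000, §2 pp. 28–30 (display (16))] -/
theorem natCard_datumSelmer_eq_mul
    (hi : ∀ (g : absoluteGaloisGroup K) (x : Φ), i (g • x) = g • i x)
    (hq : ∀ (g : absoluteGaloisGroup K) (m : M), q (g • m) = g • q m)
    (hM : ∀ m : M, Continuous fun g : absoluteGaloisGroup K ↦ g • m)
    (hinj : Function.Injective i) (hqsurj : Function.Surjective q)
    (hexact : ∀ m, q m = 0 → m ∈ i.range) (hqi : ∀ x, q (i x) = 0)
    (hunr : ∀ v : HeightOneSpectrum (𝓞 K), v ∉ S₀ → ((p : ℕ) : 𝓞 K) ∉ v.asIdeal →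
      ∀ x ∈ inertia v, ∀ m : M, x • m = m)
    (hN : ∀ v hv, (N v hv).plus = q.ker)
    (hfix : ∀ y : Ψ, (∀ h : H, h • y = y) → ∃ m : M, (∀ h : H, h • m = m) ∧ q m = y)
    (hlift : ∀ s ∈ quotSelmer H Ψ p S₀, ∃ c ∈ unramifiedOutside H M p S₀, subH1 H q hq c = s) :
    Nat.card (datumSelmer H M p N S₀) =
      Nat.card (unramifiedOutside H Φ p S₀) * Nat.card (quotSelmer H Ψ p S₀) := by
  -- `f = q_*` restricted to `S^{Σ₀}_M`
  let A : AddSubgroup (subgroupH1 H M) := datumSelmer H M p N S₀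
  let f : A →+ subgroupH1 H Ψ := (subH1 H q hq).comp A.subtype
  -- range `f = S^{Σ₀}_Ψ`
  have hrange : f.range = quotSelmer H Ψ p S₀ := by
    ext s
    constructor
    · rintro ⟨c, rfl⟩
      exact subH1_mem_quotSelmer hq hN hqsurj c.2
    · intro hs
      obtain ⟨c, hc, rfl⟩ := hlift s hs
      exact ⟨⟨c, mem_datumSelmer_of_subH1_mem_quotSelmer hq hN hqsurj hc hs⟩, rfl⟩
  -- `ker f ≃ H¹(ℚ_Σ/L, Φ)` via `i_*`
  have hinjH : Function.Injective (subH1 H i hi) :=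
    pushH1_injective_of_surjOn_fixed (q := q) (fun h m ↦ hq (h : absoluteGaloisGroup K) m) hinj
      hexact hqi hfix
  let g : unramifiedOutside H Φ p S₀ → f.ker := fun a ↦
    ⟨⟨subH1 H i hi a, subH1_mem_datumSelmer hq hN hqsurj hqi a.2⟩, by
      rw [AddMonoidHom.mem_ker]
      change subH1 H q hq (subH1 H i hi a) = 0
      exact pushH1_pushH1_eq_zero hqi _⟩
  have hg : Function.Bijective g := by
    constructor
    · intro a b hab
      have h1 := congrArg (fun x : f.ker ↦ ((x : A) : subgroupH1 H M)) hab
      exact Subtype.ext (hinjH h1)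
    · intro c
      have hc0 : subH1 H q hq ((c : A) : subgroupH1 H M) = 0 := (AddMonoidHom.mem_ker).1 c.2
      obtain ⟨a, ha, hac⟩ := exists_mem_unramifiedOutside_subH1_eq (hi := hi) hq hM hinj hqsurj
        hexact hqi hunr (c : A).2 hc0
      exact ⟨⟨a, ha⟩, Subtype.ext (Subtype.ext hac)⟩
  have hker : Nat.card f.ker = Nat.card (unramifiedOutside H Φ p S₀) :=
    (Nat.card_congr (Equiv.ofBijective g hg)).symm
  calc Nat.card A = Nat.card (A ⧸ f.ker) * Nat.card f.ker :=
        AddSubgroup.card_eq_card_quotient_mul_card_addSubgroup f.ker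
    _ = Nat.card f.range * Nat.card f.ker := by
        rw [Nat.card_congr (QuotientAddGroup.quotientKerEquivRange f).toEquiv]
    _ = Nat.card (unramifiedOutside H Φ p S₀) * Nat.card (quotSelmer H Ψ p S₀) := by
        rw [hrange, hker, mul_comm]

end NumberField

end Summit.BirchSwinnertonDyer.Rank1Residual.X2.ResidualDevissageSelmer

end
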